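import Summits.Langlands.Langlands.Theses.PrimitiveCompanionReduction
import Summits.Langlands.Langlands.Theorems.LevelOneDyadicPrimitiveProofs

/-!
# FD `PrimitiveCompanionReduction.BaseChangedCompanionCell` (stmt-Langlands-27501) — PROVED

The TWISTED base-change cell of the companion box (route-Langlands-PrimitiveCompanionReduction rev 0, crux 4; decomp-langlands lens-4
g13 node `PrimitiveCompanionCore` v2, crit-1 row 156 fix F1): for ρ in R's box with charpoly ρ = charpoly (ρ₀|Γ_K ⊗ χ), ρ₀ Lie-level-one
over K₀ with [K₀:ℚ] < [K:ℚ], χ a level-one character of Γ_K, n ≥ 2, GIVEN R on every slice lexicographically below (n, [K:ℚ]), ρ has an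
a.e.-unramified 2-adic companion.  Proof = LevelOneDyadic part 9b `Primitive.baseChangedCompanionCell_holds` (restrict the IH-companion
of ρ₀, twist by the IH-companion of χ); the route item is the node text verbatim.
-/

set_option linter.dupNamespace false

namespace Summit.Langlands.Langlands.Theorems.PrimitiveCompanionReduction

/-- FD (twisted) holds outright: the route decl `BaseChangedCompanionCell` of `PrimitiveCompanionReduction` (text byte-identical to the
lens-4 g13 node's `LevelOneDyadic.Primitive.BaseChangedCompanionCell`) is the landed theorem
`LevelOneDyadic.Primitive.baseChangedCompanionCell_holds`. -/
theorem BaseChangedCompanionCell_proof :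
    Summit.Langlands.Langlands.Theses.PrimitiveCompanionReduction.BaseChangedCompanionCell := by
  unfold Summit.Langlands.Langlands.Theses.PrimitiveCompanionReduction.BaseChangedCompanionCell
  exact Summit.Langlands.Langlands.Theorems.LevelOneDyadic.Primitive.baseChangedCompanionCell_holds

end Summit.Langlands.Langlands.Theorems.PrimitiveCompanionReduction
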